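import Mathlib
import Summits.ValiantsHypothesis.ValiantsHypothesis.Theses.ValuativeGCT
import Literature.Computability.Complexity.OccurrenceObstructionsBIP
import Summits.ValiantsHypothesis.ValiantsHypothesis.Theorems.ValuativeGCTValuativeFlipDetEquationDivisibility

/-!
# Descent of the equations of `Det_m` to degree `body - m`, and what a valuative flip needs

Wall-breaker axis D (det-orbit-closure multiplicity bounds) for crux `ValuativeGCT.ValuativeFlip`
(stmt-ValiantsHypothesis-12624): iterating the one-step stability of `…DetEquationDivisibility` along
the top coordinate `X_{d₀}` (`w₀ = -m ε_top` its weight).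

* `finrank_equations_detFormLex_eq_sub_nsmul` — for a weight `χ` of degree `D` and body
  `b = mD + χ_top`, and `j ≤ D` with `j + b ≤ D + m`, the spaces of highest-weight equations of
  `Δ(det_m)` of weights `χ` and `χ - j w₀` (degree `D - j`, same body) have the same dimension; with
  `j = D - (b - m)` the latter sits in degree `b - m`:
  `plethysmCoeff_sub_orbitMultiplicity_detFormLex_eq_sub_nsmul` (the equation count `a - K_m` descends).
* `exists_equation_of_flip` — **every witness `(U, r, δ, λ)` of the route crux `ValuativeFlip` at `(n, m)`
  forces a NONZERO HIGHEST-WEIGHT EQUATION of `Δ(det_m)` of weight `λ* - j w₀`,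
  `j = δ - min δ (bodySize λ - m)`, i.e. of the body `λ̄` of the witness and of degree
  `min δ (bodySize λ - m)`** (`K_m(λ*) ≤ dim T_U(λ) < mult_pp(λ*) ≤ a_λ` by the proved `ValuativeBound` and
  the plethysm bound, so `λ*` carries an equation, which descends).  The det half of the tail census is
  therefore a census of the equations of `Det_m` in degree `≤ body - m`.

No definitions. [new]
-/

set_option linter.dupNamespace false

namespace Summit.ValiantsHypothesis.ValiantsHypothesis.Theorems.ValuativeFlip

open MvPolynomial
open scoped BigOperators Matrix
open Literature.NumberTheory.DiophantineGeometry
open Literature.Computability.AlgebraicComplexity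
open Literature.Computability.Complexity

noncomputable section

/-- Size bookkeeping: `|χ - j • c ε_i| = |χ| - j c`. [folklore] -/
theorem bq_size_sub_nsmul_single {σ : Type*} [Fintype σ] [DecidableEq σ] (χ : Weight σ) (i : σ)
    (c : ℤ) (j : ℕ) : Weight.size (χ - j • (Pi.single i c : Weight σ)) = χ.size - j * c := by
  have h : ∀ x, (χ - j • (Pi.single i c : Weight σ)) x = χ x - j * (Pi.single i c : Weight σ) x :=
    fun x => by rw [Pi.sub_apply, Pi.smul_apply, nsmul_eq_mul]
  unfold Weight.size
  simp only [h]
  rw [Finset.sum_sub_distrib, ← Finset.mul_sum, Finset.sum_pi_single' i c, if_pos (Finset.mem_univ i)]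

/-- **Descent of the highest-weight equations of `Det_m` along the top coordinate.**  For a weight `χ`
of degree `D` (`|χ| = -mD`) and body `b = mD + χ_top`, and `j ≤ D` with `j + b ≤ D + m`, multiplication by
`X_{d₀}^j` is a bijection from the highest-weight equations of weight `χ - j w₀` (`w₀ = -m ε_top`) onto
those of weight `χ`; in particular the dimensions agree. [new] -/
theorem finrank_equations_detFormLex_eq_sub_nsmul {k : Type*} [Field k] [CharZero k] {m : ℕ} [NeZero m]
    (χ : Weight (MatIdx m)) (D b : ℕ) (hD : χ.size = -((m * D : ℕ) : ℤ))
    (hb : ((m * D : ℕ) : ℤ) + χ (topMatIdx m) = b) (j : ℕ) (hjD : j ≤ D) (hj : j + b ≤ D + m) :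
    Module.finrank k ↥(highestWeightSpace (coordRep (MatIdx m) k m) χ ⊓
        (orbitVanishingIdeal (detFormLex k m) m).restrictScalars k) =
      Module.finrank k ↥(highestWeightSpace (coordRep (MatIdx m) k m)
          (χ - j • (Pi.single (topMatIdx m) (-(m : ℤ)) : Weight (MatIdx m))) ⊓
        (orbitVanishingIdeal (detFormLex k m) m).restrictScalars k) := by
  induction j with
  | zero => rw [zero_smul, sub_zero]
  | succ j ih =>
    have ih' := ih (by omega) (by omega)
    rw [ih']
    -- one more step, at the weight `χ - j w₀` of degree `D - j`
    set ψ : Weight (MatIdx m) := χ - j • (Pi.single (topMatIdx m) (-(m : ℤ)) : Weight (MatIdx m)) with hψ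
    have hjD' : j ≤ D := by omega
    have hψsize : ψ.size = -((m * (D - j) : ℕ) : ℤ) := by
      rw [hψ, bq_size_sub_nsmul_single, hD, Nat.cast_mul, Nat.cast_mul, Nat.cast_sub hjD']
      ring
    have hψb : ((m * (D - j) : ℕ) : ℤ) + ψ (topMatIdx m) = b := by
      rw [hψ, Pi.sub_apply, Pi.smul_apply, Pi.single_eq_same, Nat.cast_mul, Nat.cast_sub hjD', ← hb,
        Nat.cast_mul, nsmul_eq_mul]
      ring
    have hle : b + 1 ≤ (D - j) + m := by omega
    have step := finrank_equations_detFormLex_eq_of_le (k := k) (topMatIdx m) (le_topMatIdx m) ψ (D - j) b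
      hψsize hψb hle
    rw [step, hψ, sub_sub, ← succ_nsmul]

/-- **The equation count of `Det_m` descends to degree `b - m`**: under the hypotheses of
`finrank_equations_detFormLex_eq_sub_nsmul`, `a(χ) - K_m(χ) = a(χ - j w₀) - K_m(χ - j w₀)`. [new] -/
theorem plethysmCoeff_sub_orbitMultiplicity_detFormLex_eq_sub_nsmul {k : Type*} [Field k] [CharZero k]
    {m : ℕ} [NeZero m] (χ : Weight (MatIdx m)) (D b : ℕ) (hD : χ.size = -((m * D : ℕ) : ℤ))
    (hb : ((m * D : ℕ) : ℤ) + χ (topMatIdx m) = b) (j : ℕ) (hjD : j ≤ D) (hj : j + b ≤ D + m) :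
    plethysmCoeff k (MatIdx m) m χ - orbitMultiplicity k (detFormLex k m) m χ =
      plethysmCoeff k (MatIdx m) m (χ - j • (Pi.single (topMatIdx m) (-(m : ℤ)) : Weight (MatIdx m))) -
        orbitMultiplicity k (detFormLex k m) m
          (χ - j • (Pi.single (topMatIdx m) (-(m : ℤ)) : Weight (MatIdx m))) := by
  have hm : m ≠ 0 := NeZero.ne m
  have h1 := plethysmCoeff_eq_orbitMultiplicity_add_finrank_equations (k := k) hm χ
  have h2 := plethysmCoeff_eq_orbitMultiplicity_add_finrank_equations (k := k) hm
    (χ - j • (Pi.single (topMatIdx m) (-(m : ℤ)) : Weight (MatIdx m)))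
  have h3 := finrank_equations_detFormLex_eq_sub_nsmul (k := k) χ D b hD hb j hjD hj
  omega

/-- **What a valuative flip needs from the determinant: an equation of `Det_m` of the witness's body,
in degree `min δ (bodySize λ - m)`.**  If at `(n, m)`, `n ≤ m`, an admissible centre `(U, r)` flips at
`λ ⊢ mδ` (`≤ m²` parts) — the body of the route decl `ValuativeFlip` verbatim — then
`K_m(λ*) ≤ dim T_U(λ) < mult_{λ*} ℂ[Δ_m(X₀₀^{m-n} per_n)] ≤ a_λ(δ[m])` (proved `ValuativeBound`, plethysm
bound), so `Δ(det_m)` has a nonzero highest-weight equation of weight `λ*`; by the descent it has one of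
weight `λ* - j w₀` with `j = δ - min δ (bodySize λ - m)`, i.e. with the same body `λ̄` and of degree
`min δ (bodySize λ - m)`.  Registered sub-goal of the crux (wall-breaker k7, axis D). [new] -/
theorem exists_equation_of_flip {n m : ℕ} [NeZero m] (hnm : n ≤ m) (U : Submodule ℂ (MatIdx m → ℂ)) (r δ : ℕ) (lam : Nat.Partition (m * δ)) (hU : ∀ u ∈ U, (Matrix.of fun a b : Fin m => u (toLex (a, b))).rank ≤ r) (hlam : lam.parts.card ≤ m * m) (hflip : (let χ : Weight (MatIdx m) := (Weight.dualOfPartition (m * m) lam).toMatIdx; let T : Submodule ℂ (MvPolynomial (MatIdx m × MatIdx m) ℂ) := MvPolynomial.homogeneousSubmodule (MatIdx m × MatIdx m) ℂ (m * δ) ⊓ ((MvPolynomial.vanishingIdeal ℂ {p : MatIdx m × MatIdx m → ℂ | ∀ j : MatIdx m, (fun i => p (j, i)) ∈ U}) ^ (δ * (m - r))).restrictScalars ℂ ⊓ (⨅ (M : Matrix (MatIdx m) (MatIdx m) ℂ) (_ : linSubst (MatIdx m) ℂ M (detFormLex ℂ m) = detFormLex ℂ m), LinearMap.ker ((MvPolynomial.aeval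 (R := ℂ) fun p : MatIdx m × MatIdx m => ∑ l : MatIdx m, M l p.2 • MvPolynomial.X (p.1, l)).toLinearMap - LinearMap.id (R := ℂ) (M := MvPolynomial (MatIdx m × MatIdx m) ℂ))) ⊓ (⨅ (g : Matrix.GeneralLinearGroup (MatIdx m) ℂ) (_ : IsUpperTriangular g), LinearMap.ker ((MvPolynomial.aeval (R := ℂ) fun p : MatIdx m × MatIdx m => ∑ l : MatIdx m, ((g⁻¹ : Matrix.GeneralLinearGroup (MatIdx m) ℂ) : Matrix (MatIdx m) (MatIdx m) ℂ) p.1 l • MvPolynomial.X (l, p.2)).toLinearMap - weightChar χ g • LinearMap.id (R := ℂ) (M := MvPolynomial (MatIdx m × MatIdx m) ℂ))); Module.finrank ℂ ↥T < orbitMultiplicity ℂ (paddedPerFormLex ℂ n m) m χ)) : ∃ F : MvPolynomial (DegIdx (MatIdx m) m) ℂ, F ≠ 0 ∧ F ∈ highestWeightSpace (coordRep (MatIdx m) ℂ m) ((Weight.dualOfPartition (m * m) lam).toMatIdx - (δ - min δ (bodySize lam - m)) • (Pi.single (topMatIdx m) (-(m : ℤ)) : Weight (MatIdx m))) ∧ F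 ∈ orbitVanishingIdeal (detFormLex ℂ m) m := by
  classical
  have hm : 0 < m := Nat.pos_of_ne_zero (NeZero.ne m)
  have hmm : 0 < m * m := Nat.mul_pos hm hm
  -- the flip forces an equation of weight `λ*`
  have h1 : orbitMultiplicity ℂ (paddedPerFormLex ℂ n m) m ((Weight.dualOfPartition (m * m) lam).toMatIdx) ≤
      plethysmCoeff ℂ (MatIdx m) m ((Weight.dualOfPartition (m * m) lam).toMatIdx) :=
    orbitMultiplicity_le_plethysmCoeff_holds _ (NeZero.ne m) (paddedPerFormLex_isHomogeneous ℂ hnm) _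
  have h3 := Summit.ValiantsHypothesis.ValiantsHypothesis.Theorems.ValuativeBound.ValuativeBound_proof
    m U r hU δ lam hlam
  have hK : orbitMultiplicity ℂ (detFormLex ℂ m) m ((Weight.dualOfPartition (m * m) lam).toMatIdx) <
      plethysmCoeff ℂ (MatIdx m) m ((Weight.dualOfPartition (m * m) lam).toMatIdx) :=
    lt_of_le_of_lt h3 (lt_of_lt_of_le hflip h1)
  have hcount := plethysmCoeff_eq_orbitMultiplicity_add_finrank_equations (k := ℂ) (NeZero.ne m)
    ((Weight.dualOfPartition (m * m) lam).toMatIdx : Weight (MatIdx m))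
  -- the descent to degree `min δ (bodySize λ - m)`
  have hsize : ((Weight.dualOfPartition (m * m) lam).toMatIdx : Weight (MatIdx m)).size = -((m * δ : ℕ) : ℤ) :=
    size_toMatIdx_dualOfPartition m lam hlam
  have hb : ((m * δ : ℕ) : ℤ) + ((Weight.dualOfPartition (m * m) lam).toMatIdx : Weight (MatIdx m)) (topMatIdx m) =
      (bodySize lam : ℤ) := by
    have htop : ((Weight.dualOfPartition (m * m) lam).toMatIdx : Weight (MatIdx m)) (topMatIdx m) =
        -((lam.parts.sup : ℕ) : ℤ) := partitionWeightLex_apply_top hmm lam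
    rw [htop]
    unfold bodySize
    have hsup := sup_parts_le lam
    rw [Nat.cast_sub hsup]
    ring
  have hposχ : 0 < Module.finrank ℂ ↥(highestWeightSpace (coordRep (MatIdx m) ℂ m)
      ((Weight.dualOfPartition (m * m) lam).toMatIdx : Weight (MatIdx m)) ⊓
      (orbitVanishingIdeal (detFormLex ℂ m) m).restrictScalars ℂ) := by omega
  by_cases hcase : bodySize lam ≤ δ + m
  · -- descend by `j = δ - min δ (bodySize λ - m)` steps
    have hdesc := finrank_equations_detFormLex_eq_sub_nsmul (k := ℂ)
      ((Weight.dualOfPartition (m * m) lam).toMatIdx : Weight (MatIdx m)) δ (bodySize lam) hsize hb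
      (δ - min δ (bodySize lam - m)) (by omega) (by omega)
    have hpos : 0 < Module.finrank ℂ ↥(highestWeightSpace (coordRep (MatIdx m) ℂ m)
        (((Weight.dualOfPartition (m * m) lam).toMatIdx : Weight (MatIdx m)) -
          (δ - min δ (bodySize lam - m)) • (Pi.single (topMatIdx m) (-(m : ℤ)) : Weight (MatIdx m))) ⊓
        (orbitVanishingIdeal (detFormLex ℂ m) m).restrictScalars ℂ) := by
      rw [← hdesc]; exact hposχ
    haveI := Module.nontrivial_of_finrank_pos hpos
    obtain ⟨F, hF0⟩ := exists_ne (0 : ↥(highestWeightSpace (coordRep (MatIdx m) ℂ m)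
        (((Weight.dualOfPartition (m * m) lam).toMatIdx : Weight (MatIdx m)) -
          (δ - min δ (bodySize lam - m)) • (Pi.single (topMatIdx m) (-(m : ℤ)) : Weight (MatIdx m))) ⊓
        (orbitVanishingIdeal (detFormLex ℂ m) m).restrictScalars ℂ))
    exact ⟨F.1, fun h => hF0 (Subtype.ext h), F.2.1, F.2.2⟩
  · -- no descent: the witness degree is already below `bodySize λ - m`
    have hj0 : δ - min δ (bodySize lam - m) = 0 := by omega
    rw [hj0, zero_smul, sub_zero]
    haveI := Module.nontrivial_of_finrank_pos hposχ
    obtain ⟨F, hF0⟩ := exists_ne (0 : ↥(highestWeightSpace (coordRep (MatIdx m) ℂ m)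
        ((Weight.dualOfPartition (m * m) lam).toMatIdx : Weight (MatIdx m)) ⊓
        (orbitVanishingIdeal (detFormLex ℂ m) m).restrictScalars ℂ))
    exact ⟨F.1, fun h => hF0 (Subtype.ext h), F.2.1, F.2.2⟩

end

end Summit.ValiantsHypothesis.ValiantsHypothesis.Theorems.ValuativeFlip
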